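import Summits.QuantumFields.YangMills.Theorems.BalabanUVNodesN15KingModelLeaves
import Summits.QuantumFields.BalabanUV.T4Continuum.Spine.NE2KingTransplantCoercive
import Literature.MathematicalPhysics.QuantumFieldTheory.Balaban1983to89.T4PairDecorrelation

/-!
# Route «BalabanUVNodes» (K4 «SpineRates»), node N15 = NE2 — THE KING-MODEL RUNG, part 6a: THE FIVE LEAVES OF THE UNIT-LAYER SOCKET ARE STABLE
# UNDER A LOCAL PERTURBATION TOWER (position-space currency, any finite index set) — hence King's (4.38) mechanism runs for the DRESSED tower
# `D + E`, the dressed covariances are background-LIPSCHITZ with decay uniformly in the level, and NE2's unit conjunct at ANY background family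
# follows from the FREE leaves plus two letters of the perturbation («what the curved case adds», as a theorem)

Cell `pub-ymgap`, Track A (D-0062), seat `pub-ymgap-dag-n15-d` (R134 seat, strategy s3 «King 1986 Lemma 4.5 (4.38) as the scalar kernel», gen 4;
dag-lead FAN-OUT v1.2 §N15 s3 «KING-MODEL RUNG»).  `bears_on: R4∕N15`; `--supports` the K3′ item `SpineGivenEndpointR12` (stmt-QuantumFields-19908,
rev 15; the lineage's parts 1–5 carry the K3 tag 19676).  COUNT-NEUTRAL; THEOREMS ONLY (0 `def`, 0 `sorry`, standard axioms).

WHY THIS FILE.  Parts 3–5 made the unit layer SOCKET-GENERIC: five typed leaves of a tower `k ↦ D k` of unit-lattice effective operators —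
(H1) `UniformCoercive`, (H2) `UniformCTBound`, (H2′) `UniformKernelDecay`, (H3) `EffectiveOperatorSupRate`, (H4) `VolumeSum` — give King's (4.38) at
every level (b2b `Spine.NE2KingTransplant.covarianceTowerRate_of_leaves`), NE2's typed unit conjunct at any background family (n15-a
`N15Knit.N15unit_of_kingLeaves`) and the continuum limit (part 5 `continuumLimit_of_leaves`); part 3's HONEST-SCOPE line said *what the curved case
adds = the same five predicates of `Δ^{(k)}(U)`, `B(U)` uniformly over regular `U`*.  At a background the tower is `Δ^{(k)}(U) = Δ^{(k)}(1) + E_k(U)`;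
the Spine types the perturbation route in OPERATOR-NORM currency (`Spine.BackgroundResolventTower.PerturbationLaws` (H-bd)∕(H-cons),
`Spine.NE2PerturbedLayer.towerLimitRate_perturbed_king`, whose header names «the position-space currency» as still owed) and, in position space, only
leaf (H1) under perturbation (`Spine.NE2KingTransplantCoercive.uniformCoercive_of_formSmall`).  THIS FILE supplies the rest in position space:
§1 the five leaves are STABLE under a perturbation tower `E` that is k-uniformly LOCAL at the Combes–Thomas rate (`|E_k(z,w)| ≤ c_E e^{−2κd(z,w)}` =
the socket's own (H2′) for `E`) and has a geometric ONE-STEP SUP RATE (`|E_{k+1} − E_k| ≤ ε_E r^k` = the socket's (H3) for `E`), with the explicit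
constant shifts `(γ − c_E V, ρ + c_E V, C₁ + c_E, ε + ε_E)` — `uniformKernelDecay_add`, `uniformCTBound_add` (weighted row∕column sums of a local
kernel `≤ c_E V`: `wRow_le_of_decay`∕`wCol_le_of_decay`, subadditivity `wRow_add_le`∕`wCol_add_le`), `uniformCoercive_add`∕`_of_decay` (the Schur form
bound `|⟨x, E_k x⟩| ≤ c_E V‖x‖²`, `abs_quadForm_le_of_decay`, by `T4PairDecorrelation.schur_sum_mul_le`), `effectiveOperatorSupRate_add`, bundled
`perturbedLeaves`; the ROOT for the dressed tower under the gap `ρ + ρ_B + 2c_E V < γ` (`covarianceTowerRate_add_of_leaves` = b2b's assembly FIRED on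
the perturbed leaves); and **BACKGROUND-LIPSCHITZ IN POSITION SPACE, UNIFORMLY IN THE LEVEL** (`inv_sub_inv_perturbed_le`:
`|(D_k + B)⁻¹(x,y) − (D_k + E_k + B)⁻¹(x,y)| ≤ c_E·(γ − ρ − ρ_B − 2c_E V)⁻²·V²·e^{−(κ∕2)d(x,y)}`, LINEAR in the perturbation size with decay — King's
(4.39)–(4.41) at ONE level, `King1986.lemma45` BY NAME; the position-space form of the Spine's NE2-LIP `pertCov_sub_le`).
§2 **WHAT THE CURVED CASE ADDS, AS A THEOREM** (`ne2PlusUnit_of_freeLeaves_add`): for ANY family of paired instances whose unit kernel at `(i, U)` is the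
one-step η-difference of the covariances of a dressed tower `D_i + E_i(U)` read at embedded sites, the five leaves of the background-INDEPENDENT towers
`D_i` with index-uniform constants, plus — at every (3.35)∧(3.36)-regular `U` in the size window `M·α₀ ≤ a₀` — the locality letter and the two-spacing
letter of `E_i(U)` at sizes `(c_E, ε_E)` obeying the gap, give `NE2PlusUnit c35 pi Kd inΛ unitDist` (n15-a's socket on §1's perturbed leaves).  Part 6b
(`BalabanUVNodesN15KingModelPerturbedNE2`) fires §1–§2 on King's actual tower BY NAME with the background block LIVE.

HONEST FRAMING ∕ LIMITS.  Finite index sets, entrywise currency with position-space decay; every statement is OUR bookkeeping ([folklore] algebra around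
King's printed `A = 0` mechanism (4.39)–(4.41) p. 675, which print does NOT state for `A ≠ 0`: p. 670 «and A = 0, of course»); the perturbation tower is
ABSTRACT — for Bałaban's `E_k(U) = Δ^{(k)}(U) − Δ^{(k)}(1)` the two letters are exactly the Spine's (H-bd)∕(H-cons) in position-space currency: NOT
PRINTED ([B9] prints η-uniform bounds, never an η-difference), ASSERTED BY NOBODY (binders); no carrier of [B9]'s `C^{(k)}(Λ; U)` is constructed; no
`def … : Prop` is a hypothesis of anything but the displayed socket theorem.  NOT a node discharge; typed 28∕28, discharged count untouched; one finite
torus programme at fixed ε — NOT ℝ⁴ ∕ infinite volume ∕ OS ∕ mass gap ∕ Clay.  Locators only: [King1986] = C. King, CMP **102** (1986) 649–677, Lemma 4.3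
(4.18) p. 672, (4.33)–(4.34) p. 674, Lemma 4.5 (4.38) p. 674, (4.39)–(4.41) p. 675; [B9] = [Balaban1985BackgroundPropagators] CMP **99** (1985) (3.35)–(3.36)
p. 396, Thm 3.15 (3.187) p. 432 (quantifier template).
-/

noncomputable section

open scoped BigOperators Matrix
open Finset

namespace Summit.QuantumFields.YangMills.BalabanUVNodes.N15.KingModel

open Literature.MathematicalPhysics.QuantumFieldTheory.Balaban1983to89
open Literature.MathematicalPhysics.QuantumFieldTheory.Balaban1983to89.QGQInverse (Coercive)
open Literature.MathematicalPhysics.QuantumFieldTheory.Balaban1983to89.T4EtaRate (PairedInstance NE2PlusUnit)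
open Literature.MathematicalPhysics.QuantumFieldTheory.Balaban1983to89.T4PairDecorrelation (schur_sum_mul_le)
open Literature.MathematicalPhysics.QuantumFieldTheory.King1986 (wRow wCol lemma45)
open Summit.QuantumFields.BalabanUV.T4Continuum.NE2KingTransplant (IsPseudoMetric UniformCoercive UniformCTBound UniformKernelDecay
  EffectiveOperatorSupRate VolumeSum CovarianceTowerRate covarianceTowerRate_of_leaves)
open Summit.QuantumFields.BalabanUV.T4Continuum.NE2KingTransplantCoercive (coercive_of_formSmall)
open Summit.QuantumFields.YangMills.Theorems.BalabanUVNodesN15Knit (N15unit_of_kingLeaves)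

/-! ## §1 Monotonicity and additivity of the pointwise leaves -/

section Generic

variable {n : Type*} [Fintype n] [DecidableEq n]
variable {D E : ℕ → Matrix n n ℝ} {B : Matrix n n ℝ} {d : n → n → ℝ}

omit [Fintype n] [DecidableEq n] in
/-- (H2′) is monotone in its constant. [folklore] -/
theorem uniformKernelDecay_mono {C C' κ : ℝ} (h : UniformKernelDecay E d C κ) (hC : C ≤ C') :
    UniformKernelDecay E d C' κ :=
  fun k z w => (h k z w).trans (mul_le_mul_of_nonneg_right hC (Real.exp_pos _).le)

omit [Fintype n] [DecidableEq n] in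
/-- (H3) is monotone in its constant (`r ≥ 0`). [folklore] -/
theorem effectiveOperatorSupRate_mono {ε ε' r : ℝ} (hr : 0 ≤ r) (h : EffectiveOperatorSupRate E ε r) (hε : ε ≤ ε') :
    EffectiveOperatorSupRate E ε' r :=
  fun k z w => (h k z w).trans (mul_le_mul_of_nonneg_right hε (pow_nonneg hr k))

omit [Fintype n] [DecidableEq n] in
/-- **(H2′) UNDER PERTURBATION**: pointwise decay constants add, `|(D_k + E_k)(z, w)| ≤ (C₁ + c_E)e^{−2κd(z,w)}`. [folklore] -/
theorem uniformKernelDecay_add {C₁ cE κ : ℝ} (hD : UniformKernelDecay D d C₁ κ) (hE : UniformKernelDecay E d cE κ) :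
    UniformKernelDecay (D + E) d (C₁ + cE) κ := by
  intro k z w
  rw [Pi.add_apply, Matrix.add_apply, add_mul]
  exact (abs_add_le _ _).trans (add_le_add (hD k z w) (hE k z w))

omit [Fintype n] [DecidableEq n] in
/-- **(H3) UNDER PERTURBATION**: one-step sup rates at a common ratio add, `|((D + E)_{k+1} − (D + E)_k)(z, w)| ≤ (ε + ε_E)r^k`. [folklore] -/
theorem effectiveOperatorSupRate_add {ε εE r : ℝ} (hD : EffectiveOperatorSupRate D ε r) (hE : EffectiveOperatorSupRate E εE r) :
    EffectiveOperatorSupRate (D + E) (ε + εE) r := by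
  intro k z w
  have e : ((D + E) (k + 1) - (D + E) k) z w = (D (k + 1) - D k) z w + (E (k + 1) - E k) z w := by
    simp only [Pi.add_apply, Matrix.sub_apply, Matrix.add_apply]; ring
  rw [e, add_mul]
  exact (abs_add_le _ _).trans (add_le_add (hD k z w) (hE k z w))

omit [DecidableEq n] in
/-- The plain absolute ROW sums of a kernel with decay `c_E e^{−2κd}` are `≤ c_E·V` (`V` the volume sum at `κ∕2`). [folklore] -/
theorem absRowSum_le_of_decay (hd : IsPseudoMetric d) {κ cE V : ℝ} (hκ : 0 ≤ κ) (hcE : 0 ≤ cE) {M : Matrix n n ℝ}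
    (hM : ∀ z w, |M z w| ≤ cE * Real.exp (-(2 * κ * d z w))) (h4 : VolumeSum d κ V) (i : n) :
    ∑ j, |M i j| ≤ cE * V := by
  calc ∑ j, |M i j| ≤ ∑ j, cE * Real.exp (-(κ / 2 * d i j)) := sum_le_sum fun j _ => (hM i j).trans
          (mul_le_mul_of_nonneg_left (Real.exp_le_exp.mpr (by nlinarith [mul_nonneg hκ (hd.nonneg i j)])) hcE)
    _ = cE * ∑ j, Real.exp (-(κ / 2 * d i j)) := by rw [mul_sum]
    _ ≤ cE * V := mul_le_mul_of_nonneg_left (h4 i) hcE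

omit [DecidableEq n] in
/-- The plain absolute COLUMN sums of a kernel with decay `c_E e^{−2κd}` are `≤ c_E·V` (symmetry of `d`). [folklore] -/
theorem absColSum_le_of_decay (hd : IsPseudoMetric d) {κ cE V : ℝ} (hκ : 0 ≤ κ) (hcE : 0 ≤ cE) {M : Matrix n n ℝ}
    (hM : ∀ z w, |M z w| ≤ cE * Real.exp (-(2 * κ * d z w))) (h4 : VolumeSum d κ V) (j : n) :
    ∑ i, |M i j| ≤ cE * V := by
  calc ∑ i, |M i j| ≤ ∑ i, cE * Real.exp (-(κ / 2 * d j i)) := sum_le_sum fun i _ => (hM i j).trans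
          (mul_le_mul_of_nonneg_left (Real.exp_le_exp.mpr (by
            rw [hd.symm j i]; nlinarith [mul_nonneg hκ (hd.nonneg i j)])) hcE)
    _ = cE * ∑ i, Real.exp (-(κ / 2 * d j i)) := by rw [mul_sum]
    _ ≤ cE * V := mul_le_mul_of_nonneg_left (h4 j) hcE

omit [DecidableEq n] in
/-- A Combes–Thomas weighted off-diagonal ROW sum at rate `κ` of a kernel with decay `c_E e^{−2κd}` is `≤ c_E·V`
(`e^{−2κd}(e^{κd} − 1) ≤ e^{−κd} ≤ e^{−κd∕2}`). [folklore] -/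
theorem wRow_le_of_decay (hd : IsPseudoMetric d) {κ cE V : ℝ} (hκ : 0 ≤ κ) (hcE : 0 ≤ cE) {M : Matrix n n ℝ}
    (hM : ∀ z w, |M z w| ≤ cE * Real.exp (-(2 * κ * d z w))) (h4 : VolumeSum d κ V) (i : n) :
    wRow M d κ i ≤ cE * V := by
  unfold wRow
  calc ∑ j, |M i j| * (Real.exp (κ * d i j) - 1)
      ≤ ∑ j, cE * Real.exp (-(κ / 2 * d i j)) := sum_le_sum fun j _ => by
        have hdij := hd.nonneg i j
        have hw : 0 ≤ Real.exp (κ * d i j) - 1 := by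
          have := Real.one_le_exp (mul_nonneg hκ hdij); linarith
        have e1 : Real.exp (-(2 * κ * d i j)) * Real.exp (κ * d i j) = Real.exp (-(κ * d i j)) := by
          rw [← Real.exp_add]; congr 1; ring
        have h1 : Real.exp (-(κ * d i j)) ≤ Real.exp (-(κ / 2 * d i j)) :=
          Real.exp_le_exp.mpr (by nlinarith [mul_nonneg hκ hdij])
        have h2 : 0 ≤ Real.exp (-(2 * κ * d i j)) := (Real.exp_pos _).le
        calc |M i j| * (Real.exp (κ * d i j) - 1)
            ≤ cE * Real.exp (-(2 * κ * d i j)) * (Real.exp (κ * d i j) - 1) := mul_le_mul_of_nonneg_right (hM i j) hw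
          _ = cE * (Real.exp (-(κ * d i j)) - Real.exp (-(2 * κ * d i j))) := by
              rw [mul_assoc, mul_sub, mul_one, e1]
          _ ≤ cE * Real.exp (-(κ / 2 * d i j)) := mul_le_mul_of_nonneg_left (by linarith) hcE
    _ = cE * ∑ j, Real.exp (-(κ / 2 * d i j)) := by rw [mul_sum]
    _ ≤ cE * V := mul_le_mul_of_nonneg_left (h4 i) hcE

omit [DecidableEq n] in
/-- The same for the weighted COLUMN sums. [folklore] -/
theorem wCol_le_of_decay (hd : IsPseudoMetric d) {κ cE V : ℝ} (hκ : 0 ≤ κ) (hcE : 0 ≤ cE) {M : Matrix n n ℝ}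
    (hM : ∀ z w, |M z w| ≤ cE * Real.exp (-(2 * κ * d z w))) (h4 : VolumeSum d κ V) (j : n) :
    wCol M d κ j ≤ cE * V := by
  have h := wRow_le_of_decay (M := M.transpose) hd hκ hcE (fun z w => by
    rw [Matrix.transpose_apply, hd.symm z w]; exact hM w z) h4 j
  unfold wRow at h
  unfold wCol
  simpa only [Matrix.transpose_apply, hd.symm j] using h

omit [DecidableEq n] in
/-- Weighted row sums are subadditive in the kernel (nonnegative weights). [folklore] -/
theorem wRow_add_le (hd : IsPseudoMetric d) {κ : ℝ} (hκ : 0 ≤ κ) (M N : Matrix n n ℝ) (i : n) :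
    wRow (M + N) d κ i ≤ wRow M d κ i + wRow N d κ i := by
  unfold wRow
  rw [← sum_add_distrib]
  refine sum_le_sum fun j _ => ?_
  have hw : 0 ≤ Real.exp (κ * d i j) - 1 := by
    have := Real.one_le_exp (mul_nonneg hκ (hd.nonneg i j)); linarith
  rw [Matrix.add_apply, ← add_mul]
  exact mul_le_mul_of_nonneg_right (abs_add_le _ _) hw

omit [DecidableEq n] in
/-- Weighted column sums are subadditive in the kernel. [folklore] -/
theorem wCol_add_le (hd : IsPseudoMetric d) {κ : ℝ} (hκ : 0 ≤ κ) (M N : Matrix n n ℝ) (j : n) :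
    wCol (M + N) d κ j ≤ wCol M d κ j + wCol N d κ j := by
  unfold wCol
  rw [← sum_add_distrib]
  refine sum_le_sum fun i _ => ?_
  have hw : 0 ≤ Real.exp (κ * d i j) - 1 := by
    have := Real.one_le_exp (mul_nonneg hκ (hd.nonneg i j)); linarith
  rw [Matrix.add_apply, ← add_mul]
  exact mul_le_mul_of_nonneg_right (abs_add_le _ _) hw

omit [DecidableEq n] in
/-- **(H2) UNDER PERTURBATION**: a k-uniformly local perturbation `|E_k(z,w)| ≤ c_E e^{−2κd(z,w)}` moves the Combes–Thomas row∕column budget of the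
tower by at most `c_E·V`: `UniformCTBound (D + E) B d κ (ρ + c_E V) ρ_B`. [folklore] -/
theorem uniformCTBound_add (hd : IsPseudoMetric d) {κ ρ ρB cE V : ℝ} (hκ : 0 ≤ κ) (hcE : 0 ≤ cE)
    (h2 : UniformCTBound D B d κ ρ ρB) (hE : UniformKernelDecay E d cE κ) (h4 : VolumeSum d κ V) :
    UniformCTBound (D + E) B d κ (ρ + cE * V) ρB := by
  obtain ⟨hr, hc, hrB, hcB⟩ := h2
  refine ⟨fun k i => ?_, fun k j => ?_, hrB, hcB⟩
  · show wRow (D k + E k) d κ i ≤ _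
    exact (wRow_add_le hd hκ _ _ i).trans (add_le_add (hr k i) (wRow_le_of_decay hd hκ hcE (hE k) h4 i))
  · show wCol (D k + E k) d κ j ≤ _
    exact (wCol_add_le hd hκ _ _ j).trans (add_le_add (hc k j) (wCol_le_of_decay hd hκ hcE (hE k) h4 j))

omit [DecidableEq n] in
/-- **SCHUR FORM BOUND of a local kernel**: `|⟨x, Mx⟩| ≤ c_E·V·⟨x, x⟩` when `|M(z,w)| ≤ c_E e^{−2κd(z,w)}` (row and column sums `≤ c_E V`, then the
quadratic Schur test `T4PairDecorrelation.schur_sum_mul_le`). [folklore] -/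
theorem abs_quadForm_le_of_decay (hd : IsPseudoMetric d) {κ cE V : ℝ} (hκ : 0 ≤ κ) (hcE : 0 ≤ cE) {M : Matrix n n ℝ}
    (hM : ∀ z w, |M z w| ≤ cE * Real.exp (-(2 * κ * d z w))) (h4 : VolumeSum d κ V) (x : n → ℝ) :
    |x ⬝ᵥ (M *ᵥ x)| ≤ cE * V * (x ⬝ᵥ x) := by
  have h1 : |x ⬝ᵥ (M *ᵥ x)| ≤ ∑ p, ∑ q, |M p q| * (|x p| * |x q|) := by
    calc |x ⬝ᵥ (M *ᵥ x)| = |∑ p, ∑ q, x p * (M p q * x q)| := by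
            simp only [dotProduct, Matrix.mulVec, mul_sum]
      _ ≤ ∑ p, |∑ q, x p * (M p q * x q)| := abs_sum_le_sum_abs _ _
      _ ≤ ∑ p, ∑ q, |x p * (M p q * x q)| := sum_le_sum fun p _ => abs_sum_le_sum_abs _ _
      _ = ∑ p, ∑ q, |M p q| * (|x p| * |x q|) := sum_congr rfl fun p _ => sum_congr rfl fun q _ => by
            rw [abs_mul, abs_mul]; ring
  have h2 := schur_sum_mul_le (univ : Finset n) (fun p q => |M p q|) x (C := cE * V) (fun p _ q _ => abs_nonneg _)
    (fun p _ => absRowSum_le_of_decay hd hκ hcE hM h4 p) (fun q _ => absColSum_le_of_decay hd hκ hcE hM h4 q)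
  have h3 : ∑ p, x p ^ 2 = x ⬝ᵥ x := by simp only [dotProduct, sq]
  calc |x ⬝ᵥ (M *ᵥ x)| ≤ ∑ p, ∑ q, |M p q| * (|x p| * |x q|) := h1
    _ ≤ cE * V * ∑ p, x p ^ 2 := h2
    _ = cE * V * (x ⬝ᵥ x) := by rw [h3]

omit [DecidableEq n] in
/-- **(H1) UNDER PERTURBATION** (via `NE2KingTransplantCoercive.coercive_of_formSmall` at every level): a k-uniformly form-small perturbation
`|⟨x, E_k x⟩| ≤ δ‖x‖²` costs `δ` of coercivity: `UniformCoercive (D + E) B (γ − δ)`. [folklore] -/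
theorem uniformCoercive_add {γ δ : ℝ} (h1 : UniformCoercive D B γ) (hδ : ∀ (k : ℕ) (x : n → ℝ), |x ⬝ᵥ (E k *ᵥ x)| ≤ δ * (x ⬝ᵥ x)) :
    UniformCoercive (D + E) B (γ - δ) := by
  intro k
  refine coercive_of_formSmall (h1 k) fun x => ?_
  have e : (D + E) k + B - (D k + B) = E k := by rw [Pi.add_apply]; abel
  rw [e]
  exact hδ k x

omit [DecidableEq n] in
/-- **(H1) UNDER A LOCAL PERTURBATION**: `UniformCoercive (D + E) B (γ − c_E V)`. [folklore] -/
theorem uniformCoercive_add_of_decay (hd : IsPseudoMetric d) {γ κ cE V : ℝ} (hκ : 0 ≤ κ) (hcE : 0 ≤ cE)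
    (h1 : UniformCoercive D B γ) (hE : UniformKernelDecay E d cE κ) (h4 : VolumeSum d κ V) :
    UniformCoercive (D + E) B (γ - cE * V) :=
  uniformCoercive_add h1 fun k x => abs_quadForm_le_of_decay hd hκ hcE (hE k) h4 x

omit [DecidableEq n] in
/-- **THE FIVE LEAVES ARE STABLE UNDER A LOCAL PERTURBATION TOWER WITH ITS OWN ONE-STEP RATE.**  If `D, B, d` carry the five leaves with constants
`(γ, κ, ρ, ρ_B, C₁, ε, r, V)` and the perturbation tower `E` is k-uniformly local, `|E_k(z,w)| ≤ c_E e^{−2κd(z,w)}` (its (H2′)), with a geometric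
one-step sup rate `|E_{k+1} − E_k| ≤ ε_E r^k` (its (H3)), then `D + E, B, d` carry the five leaves with constants
`(γ − c_E V, κ, ρ + c_E V, ρ_B, C₁ + c_E, ε + ε_E, r, V)`. [folklore] -/
theorem perturbedLeaves (hd : IsPseudoMetric d) {γ κ ρ ρB ε C₁ V r cE εE : ℝ} (hκ : 0 ≤ κ) (hcE : 0 ≤ cE)
    (h1 : UniformCoercive D B γ) (h2 : UniformCTBound D B d κ ρ ρB) (h2' : UniformKernelDecay D d C₁ κ)
    (h3 : EffectiveOperatorSupRate D ε r) (h4 : VolumeSum d κ V)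
    (hE : UniformKernelDecay E d cE κ) (hE' : EffectiveOperatorSupRate E εE r) :
    UniformCoercive (D + E) B (γ - cE * V) ∧ UniformCTBound (D + E) B d κ (ρ + cE * V) ρB ∧
      UniformKernelDecay (D + E) d (C₁ + cE) κ ∧ EffectiveOperatorSupRate (D + E) (ε + εE) r ∧ VolumeSum d κ V :=
  ⟨uniformCoercive_add_of_decay hd hκ hcE h1 hE h4, uniformCTBound_add hd hκ hcE h2 hE h4, uniformKernelDecay_add h2' hE,
    effectiveOperatorSupRate_add h3 hE', h4⟩

/-- **THE ROOT FOR THE PERTURBED TOWER** — b2b's assembly `covarianceTowerRate_of_leaves` on the perturbed leaves: under the gap condition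
`ρ + ρ_B + 2c_E V < γ`, `|(D_k + E_k + B)⁻¹(x,y) − (D_{k+1} + E_{k+1} + B)⁻¹(x,y)| ≤ C_E·(√r)^k·e^{−(κ∕2)d(x,y)}` at every level with
`C_E = √((ε + ε_E)·2(C₁ + c_E))·(γ − ρ − ρ_B − 2c_E V)⁻²·V²`. [cite: King1986, Lemma 4.5 (4.38) p.674, (4.39)–(4.41) p.675 (the mechanism, at A = 0)] -/
theorem covarianceTowerRate_add_of_leaves (hd : IsPseudoMetric d) {γ κ ρ ρB ε C₁ V r cE εE : ℝ} (hκ : 0 ≤ κ) (hcE : 0 ≤ cE)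
    (hε : 0 ≤ ε) (hεE : 0 ≤ εE) (hr : 0 ≤ r) (hgap : ρ + ρB + 2 * (cE * V) < γ)
    (h1 : UniformCoercive D B γ) (h2 : UniformCTBound D B d κ ρ ρB) (h2' : UniformKernelDecay D d C₁ κ)
    (h3 : EffectiveOperatorSupRate D ε r) (h4 : VolumeSum d κ V)
    (hE : UniformKernelDecay E d cE κ) (hE' : EffectiveOperatorSupRate E εE r) :
    CovarianceTowerRate (D + E) B d
      (Real.sqrt ((ε + εE) * (2 * (C₁ + cE))) * (((γ - cE * V) - ((ρ + cE * V) + ρB))⁻¹) ^ 2 * V ^ 2) (κ / 2) (Real.sqrt r) := by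
  obtain ⟨g1, g2, g2', g3, g4⟩ := perturbedLeaves hd hκ hcE h1 h2 h2' h3 h4 hE hE'
  exact covarianceTowerRate_of_leaves (D + E) B d hd (by linarith) hκ (add_nonneg hε hεE) hr g1 g2 g2' g3 g4

omit [DecidableEq n] in
/-- Coercivity weakens with the constant. [folklore] -/
theorem coercive_of_le {S : Matrix n n ℝ} {γ γ' : ℝ} (h : Coercive S γ) (hle : γ' ≤ γ) : Coercive S γ' := fun x =>
  (mul_le_mul_of_nonneg_right hle (Literature.LinearAlgebra.Matrix.dotProduct_self_nonneg_real x)).trans (h x)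

/-- **BACKGROUND-LIPSCHITZ IN POSITION SPACE, UNIFORMLY IN THE LEVEL** (King's resolvent identity (4.39)–(4.41) = `King1986.lemma45`, applied to
the pair `(D_k + B, D_k + E_k + B)` at ONE level): under the gap condition, for every `k` and all sites,
`|(D_k + B)⁻¹(x,y) − (D_k + E_k + B)⁻¹(x,y)| ≤ c_E·(γ − ρ − ρ_B − 2c_E V)⁻²·V²·e^{−(κ∕2)d(x,y)}` — LINEAR in the perturbation's size `c_E`, with decay.
(Only (H1), (H2), (H4) of the tower and the locality of `E` are used.) [cite: King1986, (4.39)–(4.41) p.675 (the mechanism, at A = 0)] -/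
theorem inv_sub_inv_perturbed_le (hd : IsPseudoMetric d) {γ κ ρ ρB cE V : ℝ} (hκ : 0 ≤ κ) (hcE : 0 ≤ cE)
    (hgap : ρ + ρB + 2 * (cE * V) < γ)
    (h1 : UniformCoercive D B γ) (h2 : UniformCTBound D B d κ ρ ρB) (h4 : VolumeSum d κ V)
    (hE : UniformKernelDecay E d cE κ) (k : ℕ) (x y : n) :
    |(D k + B)⁻¹ x y - (D k + E k + B)⁻¹ x y|
      ≤ cE * (((γ - cE * V) - ((ρ + cE * V) + ρB))⁻¹) ^ 2 * V ^ 2 * Real.exp (-(κ / 2 * d x y)) := by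
  obtain ⟨hr, hc, hrB, hcB⟩ := h2
  have hV0 : 0 ≤ V := (sum_nonneg fun z _ => (Real.exp_pos _).le).trans (h4 x)
  have hcV : 0 ≤ cE * V := mul_nonneg hcE hV0
  have hco := uniformCoercive_add_of_decay hd hκ hcE h1 hE h4 k
  rw [Pi.add_apply] at hco
  refine lemma45 (D k) (D k + E k) B d (by linarith) hκ hcE (coercive_of_le (h1 k) (by linarith)) hco hd.symm hd.zero hd.tri
    (fun i => (hr k i).trans (by linarith)) (fun i => ?_) hrB (fun j => (hc k j).trans (by linarith)) (fun j => ?_) hcB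
    (fun z w => ?_) h4 x y
  · exact (wRow_add_le hd hκ _ _ i).trans (add_le_add (hr k i) (wRow_le_of_decay hd hκ hcE (hE k) h4 i))
  · exact (wCol_add_le hd hκ _ _ j).trans (add_le_add (hc k j) (wCol_le_of_decay hd hκ hcE (hE k) h4 j))
  · have e : (D k + E k - D k) z w = E k z w := by simp only [Matrix.sub_apply, Matrix.add_apply]; ring
    rw [e]
    exact (hE k z w).trans (mul_le_mul_of_nonneg_left (Real.exp_le_exp.mpr (by nlinarith [mul_nonneg hκ (hd.nonneg z w)])) hcE)

end Generic

/-! ## §2 What the curved case adds, as a theorem: the unit conjunct at ANY background family from the FREE leaves plus two letters of the perturbation -/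

section Socket

/-- **NE2's UNIT CONJUNCT AT ANY BACKGROUND CARRIER FAMILY ⇐ THE FIVE LEAVES OF A BACKGROUND-INDEPENDENT TOWER + TWO LETTERS OF THE PERTURBATION.**
For a family of paired instances `pi` whose unit kernel at `(i, U)` is the one-step η-difference of the covariances of the DRESSED tower
`D_i + E_i(U)` (`D_i` independent of the background, `E_i(U)` the background's perturbation, `B_i` the block term), read at embedded sites: if the free
towers carry the five leaves with index-uniform constants and, at every `(3.35)∧(3.36)`-regular `U` (size window `M·α₀ ≤ a₀`), the perturbation is
k-uniformly LOCAL at the Combes–Thomas rate (`UniformKernelDecay (E_i U) d_i c_E κ`) with a geometric ONE-STEP SUP RATE (`EffectiveOperatorSupRate (E_i U)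
ε_E r`), and the gap `ρ + ρ_B + 2c_E V < γ` holds, then `NE2PlusUnit c35 pi Kd inΛ unitDist` — n15-a's socket `N15Knit.N15unit_of_kingLeaves` on the
perturbed leaves of §1.  The two letters are, for Bałaban's `E_k(U) = Δ^{(k)}(U) − Δ^{(k)}(1)`, the position-space form of b2b's (H-bd)∕(H-cons)
(`Spine.NE2PerturbedLayer`): NOT PRINTED, asserted by nobody here (binders). [cite: King1986, Lemma 4.5 (4.38) p.674 (scalar A = 0 template); Balaban1985BackgroundPropagators, Thm 3.15 (3.187) p.432 (quantifier template)] -/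
theorem ne2PlusUnit_of_freeLeaves_add {I : Type} {c35 a₀ : ℝ} (ha : 0 < a₀) {pi : I → PairedInstance}
    {Kd : ∀ i, B9.SiteKernel (pi i).gc (pi i).Bf} {inΛ : ∀ i, (pi i).gc.Site → Prop}
    {unitDist : ∀ i, (pi i).gc.Site → (pi i).gc.Site → ℝ}
    {m : I → Type} [∀ i, Fintype (m i)] [∀ i, DecidableEq (m i)]
    (e : ∀ i, (pi i).gc.Site → m i) (dm : ∀ i, m i → m i → ℝ)
    (D : ∀ i, ℕ → Matrix (m i) (m i) ℝ) (Ebg : ∀ i, (pi i).Bf.Cfg → ℕ → Matrix (m i) (m i) ℝ) (B : ∀ i, Matrix (m i) (m i) ℝ)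
    {γ κ ρ ρB ε C₁ V r cE εE : ℝ} (hgap : ρ + ρB + 2 * (cE * V) < γ) (hκ : 0 < κ) (hεpos : 0 < ε + εE)
    (hC₁ : 0 < C₁ + cE) (hcE : 0 ≤ cE) (hV : 0 < V) (hr0 : 0 < r) (hr1 : r < 1)
    (hd : ∀ i, IsPseudoMetric (dm i)) (hdist : ∀ i y y', unitDist i y y' ≤ dm i (e i y) (e i y'))
    (hfree : ∀ i, UniformCoercive (D i) (B i) γ ∧ UniformCTBound (D i) (B i) (dm i) κ ρ ρB ∧ UniformKernelDecay (D i) (dm i) C₁ κ ∧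
      EffectiveOperatorSupRate (D i) ε r ∧ VolumeSum (dm i) κ V)
    (hE : ∀ (i : I) (α₀ : ℝ), 0 < α₀ → (pi i).gf.M * α₀ ≤ a₀ → ∀ U : (pi i).Bf.Cfg,
      (pi i).Bf.Reg335 c35 α₀ U → (pi i).Bf.Reg336 c35 α₀ U →
        UniformKernelDecay (Ebg i U) (dm i) cE κ ∧ EffectiveOperatorSupRate (Ebg i U) εE r ∧
        ∀ y y', (Kd i).ker U y y' =
          (D i ((pi i).gc.k + 1) + Ebg i U ((pi i).gc.k + 1) + B i)⁻¹ (e i y) (e i y')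
            - (D i (pi i).gc.k + Ebg i U (pi i).gc.k + B i)⁻¹ (e i y) (e i y')) :
    NE2PlusUnit c35 pi Kd inΛ unitDist := by
  refine N15unit_of_kingLeaves (γ := γ - cE * V) (ρ := ρ + cE * V) (ρB := ρB) ha e dm (fun i U => D i + Ebg i U) (fun i _ => B i)
    (by linarith) hκ hεpos hC₁ hV hr0 hr1 hd hdist fun i α₀ hα hMa U h335 h336 => ?_
  obtain ⟨g1, g2, g2', g3, g4⟩ := hfree i
  obtain ⟨l1, l2, hker⟩ := hE i α₀ hα hMa U h335 h336
  obtain ⟨p1, p2, p2', p3, p4⟩ := perturbedLeaves (hd i) hκ.le hcE g1 g2 g2' g3 g4 l1 l2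
  exact ⟨p1, p2, p2', p3, p4, fun y y' => by rw [hker y y']; rfl⟩

end Socket

end Summit.QuantumFields.YangMills.BalabanUVNodes.N15.KingModel

end
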